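import Literature.MathematicalPhysics.KineticTheory.InfiniteChainGibbsBondForceByParts
import Literature.MathematicalPhysics.KineticTheory.InfiniteChainShiftInvariantUniqueness
import Literature.MathematicalPhysics.KineticTheory.InfiniteChainCurrentMoments
import HarnessLib

/-!
# Stub CVS-I `stub_bondForceIdentity` of line `Sketch` (crux `DrudeDissolution`, stmt-AtomisticToContinuum-12593):
# the Schwinger–Dyson identity for the bond force under the shift-invariant DLR state of the pinned chain

`--supports stmt-AtomisticToContinuum-12593` (lead `prover-line-stmt-AtomisticToContinuum-12593-c5-0`). For
`pinnedChain ω₂ lam β γ` (all `> 0`), `T > 0` and a DLR state `μ` at `T` invariant under the unit lattice shift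
(`r₀ = q₁ − q₀`, `r₁ = q₂ − q₁`, `r₋₁ = q₀ − q₋₁`, `V'(r) = r + βr³`, `U'(q) = ω₂q + lam q³`): `μ` is THE shift-invariant
DLR state, hence superstable (`hasSuperstabilityEstimate_of_isShiftInvariant_pinnedChain`), so positions are dominated by
the local energy of the box `{−2,…,2}` (`pinnedChain_abs_fst_le_bmLocalEnergy`) and every polynomial moment needed is
finite; the two one-site identities of `Literature.….InfiniteChainGibbsBondForceByParts` subtract to
`2T ∫ V''(r₀) dμ = ∫ V'(r₀)·(U'(q₁) − U'(q₀) + 2V'(r₀) − V'(r₁) − V'(r₋₁)) dμ`, and shift invariance gives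
`∫V'(r₁)² = ∫V'(r₀)² = ∫V'(r₋₁)²` — exactly the input of the landed moment-algebra stub
`stub_bondForceVariance_of_identity` (`∫V'(r₀)² = O(T)`), hence of `StationaryCorrelationBound` (route KineticCorner,
stmt-3435) through `stub_currentVariance_of_bondForce` and `stub_absCurrentCorrelation_le`.
-/

noncomputable section

open MeasureTheory ProbabilityTheory Filter Set Real
open scoped ENNReal Topology

namespace Summit.AtomisticToContinuum.FouriersLaw.Theorems.DrudeDissolution.LineSketch

open Literature.MathematicalPhysics.KineticTheory.HeatConduction
open Literature.MathematicalPhysics.KineticTheory.HeatConduction.OscillatorChain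
open Literature.Probability.LatticeModels

section PinnedChain

variable {ω₂ lam β γ : ℝ}

/-! ## Moments of the shift-invariant DLR state and the assembly -/

/-- **Positions are dominated by the local energy** for the pinned chain (`ω₂ > 0`, `lam, β ≥ 0`):
`|q_x| ≤ (1 + 2/ω₂) W_{m,k}(σ)` for `x ∈ Λ_{m,k}` (`ω₂ q²/2 + 1 ≤ W`, `|q| ≤ 1 + q²`). [folklore] -/
theorem pinnedChain_abs_fst_le_bmLocalEnergy (hω : 0 < ω₂) (hl : 0 ≤ lam) (hβ : 0 ≤ β) {m : ℤ} {k : ℕ}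
    (σ : ChainConfig) {x : ℤ} (hx : x ∈ Finset.Icc (m - k) (m + k)) :
    |(σ x).1| ≤ (1 + 2 / ω₂) * (pinnedChain ω₂ lam β γ).bmLocalEnergy m k σ := by
  have hU0 : ∀ r, 0 ≤ (pinnedChain ω₂ lam β γ).U r := pinnedChain_U_nonneg β γ hω.le hl
  have hV0 : ∀ r, 0 ≤ (pinnedChain ω₂ lam β γ).V r := fun r => by
    show 0 ≤ r ^ 2 / 2 + β * r ^ 4 / 4; positivity
  have h := site_le_bmLocalEnergy hU0 hV0 σ hx
  set W := (pinnedChain ω₂ lam β γ).bmLocalEnergy m k σ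
  have hUq : (pinnedChain ω₂ lam β γ).U (σ x).1 = ω₂ * (σ x).1 ^ 2 / 2 + lam * (σ x).1 ^ 4 / 4 := rfl
  rw [hUq] at h
  set q := (σ x).1
  have hp : 0 ≤ (σ x).2 ^ 2 / 2 := by positivity
  have hl4 : 0 ≤ lam * q ^ 4 / 4 := by positivity
  have hq2 : ω₂ * q ^ 2 / 2 + 1 ≤ W := by linarith
  have hW1 : 1 ≤ W := by nlinarith [sq_nonneg q]
  have hqq : q ^ 2 ≤ 2 / ω₂ * W := by
    rw [div_mul_eq_mul_div, le_div_iff₀ hω]; nlinarith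
  have habs : |q| ≤ 1 + q ^ 2 := by
    rcases le_or_gt (|q|) 1 with h1 | h1
    · linarith [sq_nonneg q]
    · have : |q| ≤ |q| ^ 2 := by nlinarith
      rw [sq_abs] at this; linarith
  calc |q| ≤ 1 + q ^ 2 := habs
    _ ≤ W + 2 / ω₂ * W := add_le_add hW1 hqq
    _ = (1 + 2 / ω₂) * W := by ring

/-- **CVS-I `stub_bondForceIdentity`** (registered stub of line `Sketch`, crux `DrudeDissolution`, stmt-12593):
for `pinnedChain ω₂ lam β γ` (all `> 0`), `T > 0` and a DLR state `μ` at `T` invariant under the unit shift — the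
integrability of the moments `r₀^k` (`k ≤ 6`), `V'(r₀)²`, `V'(r₁)²`, `V'(r₋₁)²`, `V'(r₀)V'(r₁)`, `V'(r₀)V'(r₋₁)`,
`V'(r₀)(U'(q₁) − U'(q₀))` (superstability of THE shift-invariant DLR state), the shift-invariance equalities
`∫V'(r₁)² = ∫V'(r₀)² = ∫V'(r₋₁)²`, and the Schwinger–Dyson identity
`2T ∫ V''(r₀) dμ = ∫ V'(r₀)·(U'(q₁) − U'(q₀) + 2V'(r₀) − V'(r₁) − V'(r₋₁)) dμ`
(difference of the one-site integration-by-parts identities at sites `1` and `0` for `g = V'(q₁ − q₀)`).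
[folklore] -/
theorem stub_bondForceIdentity :
    ∀ ω₂ lam β γ : ℝ, 0 < ω₂ → 0 < lam → 0 < β → 0 < γ →
      ∀ (T : ℝ) (μ : MeasureTheory.Measure Literature.MathematicalPhysics.KineticTheory.HeatConduction.ChainConfig),
        0 < T →
        (Literature.MathematicalPhysics.KineticTheory.HeatConduction.pinnedChain ω₂ lam β γ).IsChainGibbsMeasure T μ →
        MeasureTheory.MeasurePreserving
          (fun σ : Literature.MathematicalPhysics.KineticTheory.HeatConduction.ChainConfig => fun i : ℤ => σ (i + 1)) μ μ →
        (∀ k : ℕ, k ≤ 6 → MeasureTheory.Integrable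
          (fun σ : Literature.MathematicalPhysics.KineticTheory.HeatConduction.ChainConfig =>
            ((σ 1).1 - (σ 0).1) ^ k) μ) ∧
        MeasureTheory.Integrable (fun σ : Literature.MathematicalPhysics.KineticTheory.HeatConduction.ChainConfig =>
          ((σ 1).1 - (σ 0).1 + β * ((σ 1).1 - (σ 0).1) ^ 3) ^ 2) μ ∧
        MeasureTheory.Integrable (fun σ : Literature.MathematicalPhysics.KineticTheory.HeatConduction.ChainConfig =>
          ((σ 2).1 - (σ 1).1 + β * ((σ 2).1 - (σ 1).1) ^ 3) ^ 2) μ ∧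
        MeasureTheory.Integrable (fun σ : Literature.MathematicalPhysics.KineticTheory.HeatConduction.ChainConfig =>
          ((σ 0).1 - (σ (-1)).1 + β * ((σ 0).1 - (σ (-1)).1) ^ 3) ^ 2) μ ∧
        MeasureTheory.Integrable (fun σ : Literature.MathematicalPhysics.KineticTheory.HeatConduction.ChainConfig =>
          ((σ 1).1 - (σ 0).1 + β * ((σ 1).1 - (σ 0).1) ^ 3) *
            ((σ 2).1 - (σ 1).1 + β * ((σ 2).1 - (σ 1).1) ^ 3)) μ ∧
        MeasureTheory.Integrable (fun σ : Literature.MathematicalPhysics.KineticTheory.HeatConduction.ChainConfig =>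
          ((σ 1).1 - (σ 0).1 + β * ((σ 1).1 - (σ 0).1) ^ 3) *
            ((σ 0).1 - (σ (-1)).1 + β * ((σ 0).1 - (σ (-1)).1) ^ 3)) μ ∧
        MeasureTheory.Integrable (fun σ : Literature.MathematicalPhysics.KineticTheory.HeatConduction.ChainConfig =>
          ((σ 1).1 - (σ 0).1 + β * ((σ 1).1 - (σ 0).1) ^ 3) *
            ((ω₂ * (σ 1).1 + lam * (σ 1).1 ^ 3) - (ω₂ * (σ 0).1 + lam * (σ 0).1 ^ 3))) μ ∧
        (∫ σ, ((σ 2).1 - (σ 1).1 + β * ((σ 2).1 - (σ 1).1) ^ 3) ^ 2 ∂μ =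
          ∫ σ, ((σ 1).1 - (σ 0).1 + β * ((σ 1).1 - (σ 0).1) ^ 3) ^ 2 ∂μ) ∧
        (∫ σ, ((σ 0).1 - (σ (-1)).1 + β * ((σ 0).1 - (σ (-1)).1) ^ 3) ^ 2 ∂μ =
          ∫ σ, ((σ 1).1 - (σ 0).1 + β * ((σ 1).1 - (σ 0).1) ^ 3) ^ 2 ∂μ) ∧
        2 * T * ∫ σ, (1 + 3 * β * ((σ 1).1 - (σ 0).1) ^ 2) ∂μ =
          ∫ σ, ((σ 1).1 - (σ 0).1 + β * ((σ 1).1 - (σ 0).1) ^ 3) *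
            (((ω₂ * (σ 1).1 + lam * (σ 1).1 ^ 3) - (ω₂ * (σ 0).1 + lam * (σ 0).1 ^ 3)) +
              2 * ((σ 1).1 - (σ 0).1 + β * ((σ 1).1 - (σ 0).1) ^ 3) -
              ((σ 2).1 - (σ 1).1 + β * ((σ 2).1 - (σ 1).1) ^ 3) -
              ((σ 0).1 - (σ (-1)).1 + β * ((σ 0).1 - (σ (-1)).1) ^ 3)) ∂μ := by
  intro ω₂ lam β γ hω hl hβ _hγ T μ hT hG hshift
  haveI : IsProbabilityMeasure μ := hG.isProbabilityMeasure
  have hShiftInv : IsShiftInvariant μ := hshift.map_eq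
  have hss : (pinnedChain ω₂ lam β γ).HasSuperstabilityEstimate μ :=
    hasSuperstabilityEstimate_of_isShiftInvariant_pinnedChain γ hω hl.le hβ.le hT hG hShiftInv
  have hU0 : ∀ r, 0 ≤ (pinnedChain ω₂ lam β γ).U r := pinnedChain_U_nonneg β γ hω.le hl.le
  have hV0 : ∀ r, 0 ≤ (pinnedChain ω₂ lam β γ).V r := fun r => by
    show 0 ≤ r ^ 2 / 2 + β * r ^ 4 / 4; positivity
  have hUm := measurable_pinnedChain_U ω₂ lam β γ
  have hVm : Measurable (pinnedChain ω₂ lam β γ).V := (continuous_pinnedChain_V ω₂ lam β γ).measurable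
  have hq : ∀ x : ℤ, Measurable fun σ : ChainConfig => (σ x).1 := fun x => (measurable_pi_apply x).fst
  -- the local energy of the box `{-2,…,2}` and the position scale `Q = 2(1 + 2/ω₂) W`
  set W : ChainConfig → ℝ := fun σ => (pinnedChain ω₂ lam β γ).bmLocalEnergy 0 2 σ with hWdef
  obtain ⟨C₀, lam₀, -, -, hmom⟩ := hss.exists_integral_bmLocalEnergy_pow_le hU0 hV0 hUm hVm
  have hW6 : Integrable (fun σ => W σ ^ 6) μ := (hmom 0 2 6).1
  set κ : ℝ := 2 * (1 + 2 / ω₂) with hκ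
  have hκ0 : 0 ≤ κ := by positivity
  set Q : ChainConfig → ℝ := fun σ => κ * W σ with hQdef
  have hmem : ∀ x : ℤ, -2 ≤ x → x ≤ 2 → x ∈ Finset.Icc ((0:ℤ) - ((2:ℕ):ℤ)) (0 + ((2:ℕ):ℤ)) := by
    intro x h1 h2; simp only [Finset.mem_Icc]; omega
  have hqQ : ∀ (σ : ChainConfig) (x : ℤ), -2 ≤ x → x ≤ 2 → |(σ x).1| ≤ Q σ / 2 := by
    intro σ x h1 h2
    have h := pinnedChain_abs_fst_le_bmLocalEnergy (γ := γ) hω hl.le hβ.le σ (hmem x h1 h2)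
    have e : Q σ / 2 = (1 + 2 / ω₂) * W σ := by simp only [hQdef, hκ]; ring
    rw [e]; exact h
  have hW1 : ∀ σ, 1 ≤ W σ := fun σ => one_le_bmLocalEnergy hU0 hV0 0 2 σ
  have hQ1 : ∀ σ, 1 ≤ Q σ := by
    intro σ
    have h1 : (1:ℝ) ≤ 1 + 2 / ω₂ := le_add_of_nonneg_right (by positivity)
    have := hW1 σ
    calc (1:ℝ) ≤ 2 * (1 + 2 / ω₂) * 1 := by nlinarith
      _ ≤ 2 * (1 + 2 / ω₂) * W σ := by gcongr
  have hdiff : ∀ (σ : ChainConfig) (x y : ℤ), -2 ≤ x → x ≤ 2 → -2 ≤ y → y ≤ 2 →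
      |(σ x).1 - (σ y).1| ≤ 1 * Q σ := by
    intro σ x y hx1 hx2 hy1 hy2
    have h := abs_sub ((σ x).1) ((σ y).1)
    have := hqQ σ x hx1 hx2; have := hqQ σ y hy1 hy2
    linarith
  have hqQ' : ∀ (σ : ChainConfig) (x : ℤ), -2 ≤ x → x ≤ 2 → |(σ x).1| ≤ 1 * Q σ := by
    intro σ x h1 h2; have := hqQ σ x h1 h2; have := hQ1 σ; linarith
  -- abbreviations for the observables
  set A : ChainConfig → ℝ := fun σ => (σ 1).1 - (σ 0).1 + β * ((σ 1).1 - (σ 0).1) ^ 3 with hA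
  set B : ChainConfig → ℝ := fun σ => (σ 2).1 - (σ 1).1 + β * ((σ 2).1 - (σ 1).1) ^ 3 with hB
  set C : ChainConfig → ℝ := fun σ => (σ 0).1 - (σ (-1)).1 + β * ((σ 0).1 - (σ (-1)).1) ^ 3 with hC
  set U1 : ChainConfig → ℝ := fun σ => ω₂ * (σ 1).1 + lam * (σ 1).1 ^ 3 with hU1
  set U0 : ChainConfig → ℝ := fun σ => ω₂ * (σ 0).1 + lam * (σ 0).1 ^ 3 with hU0'
  have hAm : Measurable A := ((hq 1).sub (hq 0)).add (measurable_const.mul (((hq 1).sub (hq 0)).pow_const 3))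
  have hBm : Measurable B := ((hq 2).sub (hq 1)).add (measurable_const.mul (((hq 2).sub (hq 1)).pow_const 3))
  have hCm : Measurable C :=
    ((hq 0).sub (hq (-1))).add (measurable_const.mul (((hq 0).sub (hq (-1))).pow_const 3))
  have hU1m : Measurable U1 := (measurable_const.mul (hq 1)).add (measurable_const.mul ((hq 1).pow_const 3))
  have hU0m : Measurable U0 := (measurable_const.mul (hq 0)).add (measurable_const.mul ((hq 0).pow_const 3))
  -- pointwise bounds by `Q³`
  have hAb : ∀ σ, |A σ| ≤ (1 + β * 1 ^ 3) * Q σ ^ 3 := fun σ =>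
    abs_add_mul_cube_le hβ.le zero_le_one (hdiff σ 1 0 (by norm_num) (by norm_num) (by norm_num) (by norm_num))
      (hQ1 σ)
  have hBb : ∀ σ, |B σ| ≤ (1 + β * 1 ^ 3) * Q σ ^ 3 := fun σ =>
    abs_add_mul_cube_le hβ.le zero_le_one (hdiff σ 2 1 (by norm_num) (by norm_num) (by norm_num) (by norm_num))
      (hQ1 σ)
  have hCb : ∀ σ, |C σ| ≤ (1 + β * 1 ^ 3) * Q σ ^ 3 := fun σ =>
    abs_add_mul_cube_le hβ.le zero_le_one
      (hdiff σ 0 (-1) (by norm_num) (by norm_num) (by norm_num) (by norm_num)) (hQ1 σ)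
  have hU1b : ∀ σ, |U1 σ| ≤ (ω₂ * 1 + lam * 1 ^ 3) * Q σ ^ 3 := fun σ =>
    abs_lin_add_cube_le hω.le hl.le zero_le_one (hqQ' σ 1 (by norm_num) (by norm_num)) (hQ1 σ)
  have hU0b : ∀ σ, |U0 σ| ≤ (ω₂ * 1 + lam * 1 ^ 3) * Q σ ^ 3 := fun σ =>
    abs_lin_add_cube_le hω.le hl.le zero_le_one (hqQ' σ 0 (by norm_num) (by norm_num)) (hQ1 σ)
  -- integrability from domination by `K Q⁶ = K κ⁶ W⁶`
  have hdom : ∀ (F : ChainConfig → ℝ) (K : ℝ), Measurable F → (∀ σ, |F σ| ≤ K * Q σ ^ 6) →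
      Integrable F μ := by
    intro F K hFm hF
    have hI : Integrable (fun σ => K * κ ^ 6 * W σ ^ 6) μ := hW6.const_mul _
    refine hI.mono' hFm.aestronglyMeasurable (Eventually.of_forall fun σ => ?_)
    rw [Real.norm_eq_abs]
    calc |F σ| ≤ K * Q σ ^ 6 := hF σ
      _ = K * κ ^ 6 * W σ ^ 6 := by simp only [hQdef]; ring
  have hQ3 : ∀ σ, 0 ≤ Q σ ^ 3 := fun σ => by have := hQ1 σ; positivity
  have hprod : ∀ (F G : ChainConfig → ℝ) (a b : ℝ), (∀ σ, |F σ| ≤ a * Q σ ^ 3) → (∀ σ, |G σ| ≤ b * Q σ ^ 3) →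
      ∀ σ, |F σ * G σ| ≤ (a * b) * Q σ ^ 6 := by
    intro F G a b hF hG σ
    calc |F σ * G σ| = |F σ| * |G σ| := abs_mul _ _
      _ ≤ (a * Q σ ^ 3) * (b * Q σ ^ 3) :=
          mul_le_mul (hF σ) (hG σ) (abs_nonneg _) ((abs_nonneg _).trans (hF σ))
      _ = (a * b) * Q σ ^ 6 := by ring
  -- (1) moments `r₀^k`, `k ≤ 6`
  have hrk : ∀ k : ℕ, k ≤ 6 → Integrable (fun σ : ChainConfig => ((σ 1).1 - (σ 0).1) ^ k) μ := by
    intro k hk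
    refine hdom _ 1 (((hq 1).sub (hq 0)).pow_const k) fun σ => ?_
    have h := hdiff σ 1 0 (by norm_num) (by norm_num) (by norm_num) (by norm_num)
    rw [one_mul] at h
    rw [abs_pow, one_mul]
    calc |(σ 1).1 - (σ 0).1| ^ k ≤ Q σ ^ k := pow_le_pow_left₀ (abs_nonneg _) h k
      _ ≤ Q σ ^ 6 := pow_le_pow_right₀ (hQ1 σ) hk
  -- (2)-(7) the quadratic observables
  have hA2 : Integrable (fun σ => A σ ^ 2) μ :=
    hdom _ ((1 + β * 1 ^ 3) * (1 + β * 1 ^ 3)) (hAm.pow_const 2) fun σ => by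
      rw [pow_two]; exact hprod A A _ _ hAb hAb σ
  have hB2 : Integrable (fun σ => B σ ^ 2) μ :=
    hdom _ ((1 + β * 1 ^ 3) * (1 + β * 1 ^ 3)) (hBm.pow_const 2) fun σ => by
      rw [pow_two]; exact hprod B B _ _ hBb hBb σ
  have hC2 : Integrable (fun σ => C σ ^ 2) μ :=
    hdom _ ((1 + β * 1 ^ 3) * (1 + β * 1 ^ 3)) (hCm.pow_const 2) fun σ => by
      rw [pow_two]; exact hprod C C _ _ hCb hCb σ
  have hAB : Integrable (fun σ => A σ * B σ) μ := hdom _ _ (hAm.mul hBm) (hprod A B _ _ hAb hBb)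
  have hAC : Integrable (fun σ => A σ * C σ) μ := hdom _ _ (hAm.mul hCm) (hprod A C _ _ hAb hCb)
  have hDb : ∀ σ, |U1 σ - U0 σ| ≤ (2 * (ω₂ * 1 + lam * 1 ^ 3)) * Q σ ^ 3 := by
    intro σ
    calc |U1 σ - U0 σ| ≤ |U1 σ| + |U0 σ| := abs_sub _ _
      _ ≤ _ := by have := hU1b σ; have := hU0b σ; linarith
  have hAD : Integrable (fun σ => A σ * (U1 σ - U0 σ)) μ :=
    hdom _ _ (hAm.mul (hU1m.sub hU0m)) (hprod A (fun σ => U1 σ - U0 σ) _ _ hAb hDb)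
  -- the integrands of the two one-site identities
  have hE : Integrable (fun σ : ChainConfig => 1 + 3 * β * ((σ 1).1 - (σ 0).1) ^ 2) μ :=
    (integrable_const 1).add ((hrk 2 (by norm_num)).const_mul (3 * β))
  have hS1b : ∀ σ, |U1 σ + A σ - B σ| ≤ ((ω₂ * 1 + lam * 1 ^ 3) + (1 + β * 1 ^ 3) + (1 + β * 1 ^ 3)) * Q σ ^ 3 := by
    intro σ
    calc |U1 σ + A σ - B σ| ≤ |U1 σ + A σ| + |B σ| := abs_sub _ _
      _ ≤ |U1 σ| + |A σ| + |B σ| := by linarith [abs_add_le (U1 σ) (A σ)]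
      _ ≤ _ := by have := hU1b σ; have := hAb σ; have := hBb σ; linarith
  have hS0b : ∀ σ, |U0 σ + C σ - A σ| ≤ ((ω₂ * 1 + lam * 1 ^ 3) + (1 + β * 1 ^ 3) + (1 + β * 1 ^ 3)) * Q σ ^ 3 := by
    intro σ
    calc |U0 σ + C σ - A σ| ≤ |U0 σ + C σ| + |A σ| := abs_sub _ _
      _ ≤ |U0 σ| + |C σ| + |A σ| := by linarith [abs_add_le (U0 σ) (C σ)]
      _ ≤ _ := by have := hU0b σ; have := hAb σ; have := hCb σ; linarith
  have hI1 : Integrable (fun σ => A σ * (U1 σ + A σ - B σ)) μ :=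
    hdom _ _ (hAm.mul ((hU1m.add hAm).sub hBm)) (hprod A (fun σ => U1 σ + A σ - B σ) _ _ hAb hS1b)
  have hI0 : Integrable (fun σ => A σ * (U0 σ + C σ - A σ)) μ :=
    hdom _ _ (hAm.mul ((hU0m.add hCm).sub hAm)) (hprod A (fun σ => U0 σ + C σ - A σ) _ _ hAb hS0b)
  -- the two one-site identities
  have h₁ := pinnedChain_integral_byParts_site_one (γ := γ) hω hl.le hβ.le hT hG (hE.const_mul T) hI1
  have h₀ := pinnedChain_integral_byParts_site_zero (γ := γ) hω hl.le hβ.le hT hG (hE.neg.const_mul T) hI0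
  -- shift invariance of the quadratic bond moments
  have hBA : ∀ σ : ChainConfig, B σ = A (shift σ) := by
    intro σ
    show (σ 2).1 - (σ 1).1 + β * ((σ 2).1 - (σ 1).1) ^ 3 =
      (σ (1 + 1)).1 - (σ (0 + 1)).1 + β * ((σ (1 + 1)).1 - (σ (0 + 1)).1) ^ 3
    norm_num
  have hAC' : ∀ σ : ChainConfig, A σ = C (shift σ) := by
    intro σ
    show (σ 1).1 - (σ 0).1 + β * ((σ 1).1 - (σ 0).1) ^ 3 =
      (σ (0 + 1)).1 - (σ (-1 + 1)).1 + β * ((σ (0 + 1)).1 - (σ (-1 + 1)).1) ^ 3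
    norm_num
  have hBB : ∫ σ, B σ ^ 2 ∂μ = ∫ σ, A σ ^ 2 ∂μ := by
    rw [← hShiftInv.integral_comp_shift (fun σ => A σ ^ 2)]
    exact integral_congr_ae (Eventually.of_forall fun σ => by simp only [hBA])
  have hCC : ∫ σ, C σ ^ 2 ∂μ = ∫ σ, A σ ^ 2 ∂μ := by
    rw [← hShiftInv.integral_comp_shift (fun σ => C σ ^ 2)]
    exact integral_congr_ae (Eventually.of_forall fun σ => by simp only [hAC'])
  -- assembly
  refine ⟨hrk, hA2, hB2, hC2, hAB, hAC, hAD, hBB, hCC, ?_⟩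
  have hlhs : ∫ σ : ChainConfig, T * (-(1 + 3 * β * ((σ 1).1 - (σ 0).1) ^ 2)) ∂μ =
      -(T * ∫ σ : ChainConfig, (1 + 3 * β * ((σ 1).1 - (σ 0).1) ^ 2) ∂μ) := by
    rw [← integral_const_mul, ← integral_neg]
    exact integral_congr_ae (Eventually.of_forall fun σ => by ring)
  rw [hlhs] at h₀
  have hsub : (∫ σ, A σ * (U1 σ + A σ - B σ) ∂μ) - ∫ σ, A σ * (U0 σ + C σ - A σ) ∂μ =
      ∫ σ, A σ * ((U1 σ - U0 σ) + 2 * A σ - B σ - C σ) ∂μ := by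
    rw [← integral_sub hI1 hI0]
    exact integral_congr_ae (Eventually.of_forall fun σ => by ring)
  change T * ∫ σ : ChainConfig, (1 + 3 * β * ((σ 1).1 - (σ 0).1) ^ 2) ∂μ =
    ∫ σ, A σ * (U1 σ + A σ - B σ) ∂μ at h₁
  change -(T * ∫ σ : ChainConfig, (1 + 3 * β * ((σ 1).1 - (σ 0).1) ^ 2) ∂μ) =
    ∫ σ, A σ * (U0 σ + C σ - A σ) ∂μ at h₀
  change 2 * T * ∫ σ : ChainConfig, (1 + 3 * β * ((σ 1).1 - (σ 0).1) ^ 2) ∂μ =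
    ∫ σ, A σ * ((U1 σ - U0 σ) + 2 * A σ - B σ - C σ) ∂μ
  rw [← hsub, ← h₁, ← h₀]
  ring

end PinnedChain

end Summit.AtomisticToContinuum.FouriersLaw.Theorems.DrudeDissolution.LineSketch

end
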